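import Mathlib
import Summits.CriticalPhenomena.PercolationContinuityZ3.Theorems.PercNearOneGluingNoHeavyQuantTwoArcPatterns
import Summits.CriticalPhenomena.PercolationContinuityZ3.Theorems.PercNearOneGluingNoHeavyQuantFarSunCondition
import Summits.CriticalPhenomena.PercolationContinuityZ3.Theorems.PercNearOneGluingNoHeavyQuantFarSunArcSums
import Summits.CriticalPhenomena.PercolationContinuityZ3.Theorems.PercNearOneGluingNoHeavyQuantFarSunLawSums
import Summits.CriticalPhenomena.PercolationContinuityZ3.Theorems.PercNearOneGluingNoHeavyQuantFarSunLawAlgebra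
import HarnessLib

/-!
# QUANT lane R8, "FAR beyond trees", layer one on hairy cycles — the sun's companions as TwoArc data (bridge, part 1)

builds on p205010 (kernel theorem, internal audit signed; external expert review pending)

Support file (`--supports stmt-CriticalPhenomena-4575`), seat `prim-quant-p1` (gen 17); `quant/prim-quant-p1-g17/FOR-PROVERS-TWOARC-BRIDGE.md`.
Joins the TwoArc algebra (`…QuantTwoArcPairs/RegimeA/Hairs/HairsTwoSided/Expect/Patterns`, p1 g17) with prim-cert-1 g20's sun-law dictionary
(`…QuantFarSunLawDefs/…/Condition/ArcSums/LawSums/LawAlgebra`).  For the sun graph `C_{K+1}` with cycle weights `g` and hair weights `h`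
(`α = arcA g`, `β = arcB K g`, `c = α_{K+1}`; hair index `k` at position `k+1`) and a distinguished tip `a`:
* arcs: `arcA_mem`, `arcA_anti`, `arcB_mem`, `arcB_mono`, **`arcA_mul_arcB`** (`α_m β_m = c`);
* indicator bookkeeping for ≤ 3 tips (`card_inter_eq_sum`, `two_le_card_pair_inter`, `two_le_card_triple_inter_iff`, `ind_two_of_three`) and the
  hair-free law of "≥ 2 of the pattern reached": `sunLaw_one_single` (= 0), `sunLaw_one_two_pair` (= the pair arc sum), `sunLaw_one_two_triple`
  (= Σ pairs − 2·triple, from prim-cert-1's `sunLaw_one_pair` / `sunLaw_one_triple`);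
* the companion data: `spR = 1 − α_{a+1}`, `spL = 1 − β_{a+1}`, right companions `sfR b = (α_{a+1} − α_{b+1}, 1 − β_{b+1}, h b)`, left companions
  `sfL b = (β_{a+1} − β_{b+1}, 1 − α_{b+1}, h b)`; `xv_spL_spR` (`x = sunMarg a` when `h a = 1`), `sfR_T`/`sfL_T` (`hρ = sunMarg b`);
* generic `expect` helpers: `expect_sub_const`, `expect_congr_sublist`, `pairwise_pair_sublist`.
The assembly (`sunMarg a ≤ sunLaw (2 ≤ #·)` for a sure least-likely tip, and `SunFAR K 1` on that region) is `…QuantTwoArcSun`.  No sorries. [this work]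
-/

namespace Summit.CriticalPhenomena.PercolationContinuityZ3.Theorems

namespace Quant

namespace TwoArc

open Finset
open Summit.CriticalPhenomena.PercolationContinuityZ3.Theorems.HairyCycle

/-! ## The sun's arcs: bounds, monotonicity, and `α_m β_m = c` -/

section arcs
variable {K : ℕ} {g : ℕ → ℝ} (hg : ∀ m, m ≤ K → 0 ≤ g m ∧ g m ≤ 1)
include hg

/-- `0 ≤ α_i ≤ 1` for `i ≤ K+1`. [this work] -/
theorem arcA_mem {i : ℕ} (hi : i ≤ K + 1) : 0 ≤ arcA g i ∧ arcA g i ≤ 1 := by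
  induction i with
  | zero => simp [arcA]
  | succ i ih =>
    have h := ih (by omega); have hgi := hg i (by omega)
    rw [arcA_succ]
    exact ⟨mul_nonneg h.1 hgi.1, by nlinarith [h.1, h.2, hgi.1, hgi.2]⟩

/-- `α` is non-increasing: `i ≤ j ≤ K+1 ⟹ α_j ≤ α_i`. [this work] -/
theorem arcA_anti {i j : ℕ} (hij : i ≤ j) (hj : j ≤ K + 1) : arcA g j ≤ arcA g i := by
  induction j, hij using Nat.le_induction with
  | base => exact le_rfl
  | succ j hij ih =>
    have h := arcA_mem hg (i := j) (by omega); have hgj := hg j (by omega)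
    rw [arcA_succ]
    nlinarith [ih (by omega), h.1, hgj.1, hgj.2]

/-- `0 ≤ β_i ≤ 1`. [this work] -/
theorem arcB_mem (i : ℕ) : 0 ≤ arcB K g i ∧ arcB K g i ≤ 1 := by
  unfold arcB
  refine ⟨Finset.prod_nonneg fun m hm => (hg m (by rw [Finset.mem_Ico] at hm; omega)).1,
    Finset.prod_le_one (fun m hm => (hg m (by rw [Finset.mem_Ico] at hm; omega)).1)
      fun m hm => (hg m (by rw [Finset.mem_Ico] at hm; omega)).2⟩

/-- `β` is non-decreasing: `i ≤ j ⟹ β_i ≤ β_j`. [this work] -/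
theorem arcB_mono {i j : ℕ} (hij : i ≤ j) (hj : j ≤ K + 1) : arcB K g i ≤ arcB K g j := by
  induction j, hij using Nat.le_induction with
  | base => exact le_rfl
  | succ j hij ih =>
    have h := arcB_mem hg (K := K) (j + 1); have hgj := hg j (by omega)
    have := ih (by omega)
    rw [arcB_eq_mul g (l := j) (by omega)] at this
    nlinarith [h.1, hgj.1, hgj.2]

omit hg in
/-- `α_m · β_m = c = α_{K+1}` (the two arcs at a position partition the cycle). [this work] -/
theorem arcA_mul_arcB {m : ℕ} (hm : m ≤ K + 1) : arcA g m * arcB K g m = arcA g (K + 1) := by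
  unfold arcA arcB
  exact Finset.prod_range_mul_prod_Ico g hm

end arcs

/-! ## Indicator bookkeeping for patterns with at most three tips -/

section indicators
variable {R : Finset ℕ}

/-- `#(T ∩ R)` as a sum of membership indicators. [this work] -/
theorem card_inter_eq_sum (T R : Finset ℕ) : ((T ∩ R).card : ℕ) = ∑ x ∈ T, if x ∈ R then 1 else 0 := by
  rw [← Finset.filter_mem_eq_inter, Finset.card_filter]

/-- One tip never gives two reached tips. [this work] -/
theorem not_two_le_card_singleton_inter (a : ℕ) (R : Finset ℕ) : ¬ 2 ≤ (({a} : Finset ℕ) ∩ R).card := by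
  rw [card_inter_eq_sum, Finset.sum_singleton]; split_ifs <;> omega

/-- Two tips: both must be reached. [this work] -/
theorem two_le_card_pair_inter {u v : ℕ} (huv : u ≠ v) (R : Finset ℕ) :
    2 ≤ (({u, v} : Finset ℕ) ∩ R).card ↔ (u ∈ R ∧ v ∈ R) := by
  rw [card_inter_eq_sum, Finset.sum_insert (by simp [huv]), Finset.sum_singleton]
  split_ifs <;> simp_all

/-- Three tips: "at least two reached" as a disjunction of pairs. [this work] -/
theorem two_le_card_triple_inter_iff {u v w : ℕ} (huv : u ≠ v) (huw : u ≠ w) (hvw : v ≠ w) (R : Finset ℕ) :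
    2 ≤ (({u, v, w} : Finset ℕ) ∩ R).card ↔ ((u ∈ R ∧ v ∈ R) ∨ (u ∈ R ∧ w ∈ R) ∨ (v ∈ R ∧ w ∈ R)) := by
  have hc : (({u, v, w} : Finset ℕ) ∩ R).card
      = (if u ∈ R then 1 else 0) + (if v ∈ R then 1 else 0) + (if w ∈ R then 1 else 0) := by
    rw [card_inter_eq_sum, Finset.sum_insert (by simp [huv, huw]), Finset.sum_insert (by simp [hvw]), Finset.sum_singleton]
    ring
  rw [hc]
  by_cases hu : u ∈ R <;> by_cases hv : v ∈ R <;> by_cases hw : w ∈ R <;> simp [hu, hv, hw]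

/-- The indicator identity behind "≥ 2 of 3" (any decidability instances): `𝟙 = 𝟙_{AB} + 𝟙_{AC} + 𝟙_{BC} − 2·𝟙_{ABC}`. [this work] -/
theorem ind_two_of_three (A B C : Prop) [Decidable ((A ∧ B) ∨ (A ∧ C) ∨ (B ∧ C))] [Decidable (A ∧ B)] [Decidable (A ∧ C)]
    [Decidable (B ∧ C)] [Decidable (A ∧ B ∧ C)] :
    (if (A ∧ B) ∨ (A ∧ C) ∨ (B ∧ C) then (1 : ℝ) else 0)
      = (if A ∧ B then 1 else 0) + (if A ∧ C then 1 else 0) + (if B ∧ C then 1 else 0) - 2 * (if A ∧ B ∧ C then 1 else 0) := by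
  by_cases hA : A <;> by_cases hB : B <;> by_cases hC : C <;> simp [hA, hB, hC]
  norm_num

end indicators

/-! ## Small-pattern values of the hair-free sun law -/

section values
variable {K : ℕ} (hK : 2 ≤ K) {g : ℕ → ℝ} (hg : ∀ m, m ≤ K → 0 ≤ g m ∧ g m ≤ 1)
include hK hg

omit hK hg in
/-- Law congruence for pointwise-equivalent predicates. [this work] -/
theorem sunLaw_congr_prop {h : ℕ → ℝ} {Φ Φ' : Finset ℕ → Prop} (hΦ : ∀ R, Φ R ↔ Φ' R) : sunLaw K g h Φ = sunLaw K g h Φ' := by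
  have : Φ = Φ' := funext fun R => propext (hΦ R)
  rw [this]

omit hK hg in
/-- One tip: `sunLaw K g 1 (2 ≤ #({a} ∩ ·)) = 0`. [this work] -/
theorem sunLaw_one_single (a : ℕ) : sunLaw K g (fun _ => (1 : ℝ)) (fun R => 2 ≤ (({a} : Finset ℕ) ∩ R).card) = 0 := by
  rw [sunLaw_congr_prop (Φ' := fun _ => False) (fun R => by simp [not_two_le_card_singleton_inter]), sunLaw_false]

/-- Two tips `u < v < K`: the pair arc sum. [this work] -/
theorem sunLaw_one_two_pair {u v : ℕ} (huv : u < v) (hv : v < K) :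
    sunLaw K g (fun _ => (1 : ℝ)) (fun R => 2 ≤ (({u, v} : Finset ℕ) ∩ R).card)
      = arcA g (v + 1) + arcB K g (u + 1) + arcA g (u + 1) * arcB K g (v + 1) - 2 * arcA g (K + 1) := by
  rw [sunLaw_congr_prop (fun R => two_le_card_pair_inter (Nat.ne_of_lt huv) R)]
  exact sunLaw_one_pair hK hg huv hv

/-- Three tips `u < v < w < K`: "at least two reached" by inclusion–exclusion of the arc sums. [this work] -/
theorem sunLaw_one_two_triple {u v w : ℕ} (huv : u < v) (hvw : v < w) (hw : w < K) :
    sunLaw K g (fun _ => (1 : ℝ)) (fun R => 2 ≤ (({u, v, w} : Finset ℕ) ∩ R).card)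
      = (arcA g (v + 1) + arcB K g (u + 1) + arcA g (u + 1) * arcB K g (v + 1) - 2 * arcA g (K + 1))
        + (arcA g (w + 1) + arcB K g (u + 1) + arcA g (u + 1) * arcB K g (w + 1) - 2 * arcA g (K + 1))
        + (arcA g (w + 1) + arcB K g (v + 1) + arcA g (v + 1) * arcB K g (w + 1) - 2 * arcA g (K + 1))
        - 2 * (arcA g (w + 1) + arcB K g (u + 1) + arcA g (v + 1) * arcB K g (w + 1) + arcA g (u + 1) * arcB K g (v + 1)
          - 3 * arcA g (K + 1)) := by
  rw [← sunLaw_one_pair hK hg huv (by omega), ← sunLaw_one_pair hK hg (huv.trans hvw) hw, ← sunLaw_one_pair hK hg hvw hw,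
    ← sunLaw_one_triple hK hg huv hvw hw,
    sunLaw_congr_prop (fun R => two_le_card_triple_inter_iff (Nat.ne_of_lt huv) (Nat.ne_of_lt (huv.trans hvw)) (Nat.ne_of_lt hvw) R)]
  simp only [sunLaw_one_eq]
  rw [← Finset.sum_add_distrib, ← Finset.sum_add_distrib, Finset.mul_sum, ← Finset.sum_sub_distrib]
  refine Finset.sum_congr rfl fun p _ => ?_
  rw [ind_two_of_three]
  ring

end values

/-! ## The companions of a distinguished tip as TwoArc data -/

section data
variable (K : ℕ) (g h : ℕ → ℝ) (a : ℕ)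

/-- `p_R = 1 − α_{a+1}`. [this work] -/
def spR : ℝ := 1 - arcA g (a + 1)
/-- `p_L = 1 − β_{a+1}`. [this work] -/
def spL : ℝ := 1 - arcB K g (a + 1)
/-- Right companion `b > a`: `(α_{a+1} − α_{b+1}, 1 − β_{b+1}, h b)`. [this work] -/
def sfR (b : ℕ) : HComp := ⟨arcA g (a + 1) - arcA g (b + 1), 1 - arcB K g (b + 1), h b⟩
/-- Left companion `b < a`: `(β_{a+1} − β_{b+1}, 1 − α_{b+1}, h b)`. [this work] -/
def sfL (b : ℕ) : HComp := ⟨arcB K g (a + 1) - arcB K g (b + 1), 1 - arcA g (b + 1), h b⟩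

variable {K g h a}

/-- `x`: with `h a = 1`, `1 − p_L p_R = sunMarg K g h a`. [this work] -/
theorem xv_spL_spR (ha : a < K) (hha : h a = 1) : xv (spL K g a) (spR g a) = sunMarg K g h a := by
  have hc := arcA_mul_arcB (K := K) (g := g) (m := a + 1) (by omega)
  simp only [xv, spL, spR, sunMarg, hha, one_mul]
  linear_combination (-1 : ℝ) * hc

/-- The marginal of a companion in TwoArc coordinates, right side. [this work] -/
theorem sfR_T (b : ℕ) (hb : b < K) : (sfR K g h a b).h * (sfR K g h a b).rho (spR g a) = sunMarg K g h b := by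
  have hc := arcA_mul_arcB (K := K) (g := g) (m := b + 1) (by omega)
  simp only [sfR, HComp.rho, spR, sunMarg]
  linear_combination (-(h b)) * hc

/-- The marginal of a companion in TwoArc coordinates, left side. [this work] -/
theorem sfL_T (b : ℕ) (hb : b < K) : (sfL K g h a b).h * (sfL K g h a b).rho (spL K g a) = sunMarg K g h b := by
  have hc := arcA_mul_arcB (K := K) (g := g) (m := b + 1) (by omega)
  simp only [sfL, HComp.rho, spL, sunMarg]
  linear_combination (-(h b)) * hc

end data

/-! ## Generic helpers on `expect` -/

section expectHelpers
variable {ι : Type*} (f : ι → HComp)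

/-- Subtracting a constant. [this work] -/
theorem expect_sub_const (ks : List ι) (Ψ : List ι → ℝ) (c : ℝ) :
    expect f ks (fun Q => Ψ Q - c) = expect f ks Ψ - c := by
  induction ks generalizing Ψ with
  | nil => simp
  | cons k ks ih => simp only [expect_cons]; rw [ih, ih]; ring

/-- `expect` only evaluates the integrand on sublists. [this work] -/
theorem expect_congr_sublist {ks : List ι} {Ψ Ψ' : List ι → ℝ} (h : ∀ Q, Q.Sublist ks → Ψ Q = Ψ' Q) :
    expect f ks Ψ = expect f ks Ψ' := by
  induction ks generalizing Ψ Ψ' with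
  | nil => simpa using h [] (List.Sublist.refl _)
  | cons k ks ih =>
    simp only [expect_cons]
    rw [ih (Ψ := fun Q => Ψ (k :: Q)) (Ψ' := fun Q => Ψ' (k :: Q)) (fun Q hQ => h _ (hQ.cons_cons k)),
      ih (Ψ := Ψ) (Ψ' := Ψ') (fun Q hQ => h _ (hQ.cons k))]

/-- Every list is pairwise "the two-element sublist is a sublist". [this work] -/
theorem pairwise_pair_sublist : ∀ (L : List ι), L.Pairwise (fun j j' => [j, j'].Sublist L)
  | [] => List.Pairwise.nil
  | k :: ks => by
    rw [List.pairwise_cons]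
    refine ⟨fun j hj => ?_, (pairwise_pair_sublist ks).imp fun h => h.cons k⟩
    exact (List.singleton_sublist.2 hj).cons_cons k

end expectHelpers


end TwoArc

end Quant

end Summit.CriticalPhenomena.PercolationContinuityZ3.Theorems
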